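import Mathlib.Logic.Equiv.Defs
import Mathlib.Data.Fin.Tuple.Basic
import Mathlib.Data.Finset.Card
import Mathlib.Data.Fintype.Card
import Mathlib.Data.Fintype.Perm
import Literature.Computability.Complexity.PerfectMatchingCircuit
import HarnessLib

/-!
# A polynomial-size De Morgan circuit for bipartite perfect matching — correctness

Correctness of the layered augmenting-path circuit `BipMatch.pmFn` of
`PerfectMatchingCircuit.lean`: `pmFn x () = true ↔ HasPM x` (`BipMatch.pmFn_eq_true_iff`),
where `HasPM x` says that the bipartite graph `x ⊆ K_{m,m}` has a perfect matching
(`∃ σ : Equiv.Perm (Fin m), ∀ i, x (i, σ i)`, literally the predicate decided by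
`Literature.Barriers.PneNP.perfectMatchingFn`).

The proof is the textbook analysis of the bipartite augmenting-path algorithm
(Korte–Vygen 2018, Thm. 10.5, with Berge's Thm. 10.7 and Hall's Thm. 10.3; Hopcroft–Karp 1973;
Jukna 2012, §9.11), organised as invariants of the iterated layers:

* `BfsInv u n y` — invariant of the alternating breadth-first search from the root `u` after
  `n` rounds (reached sets `S`, `T`, unique parents, and a rank on right vertices that strictly
  decreases from a vertex to the mate of its parent); `BfsInv.step`, `bfsInv_iterate`; the
  search is complete after `2m` rounds (`bfsSt_run_fixed`, via the potential `|S| + |T|`).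
* Failure (`stuck_of_not_ok`): every reached right vertex is matched; then
  `mate : T → S ∖ {u}` and `σ : S → N(S) ⊆ T` are injective for any perfect matching `σ`,
  so `|S| ≤ |T| ≤ |S| - 1` — a Hall violator (`not_hasPM_of_stuck`).
* Success (`chooseSt_spec`): the selected reached free vertex `w₀` starts the chain
  `chain u z w₀ : ℕ → Option (Fin m)` of right path vertices (`nextR` = mate of the parent),
  along which the rank strictly decreases (`PathCtx.chain_rank`), so the chain is injective,
  ends, and ends at a child of the root (`PathCtx.exists_root_parent`); the path layers mark
  exactly the chain and its parents (`PathCtx.closure_sub`, `PathCtx.closure_sup`, fixed point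
  after `2m` rounds `pathSt_run_fixed`), and the augmented matching `NewM` is a matching
  covering the root and all previously matched left vertices (`PathCtx.newM_row/col/root/…`).
* `PhaseInv x u y` — after the phases of the roots `< u` the state holds a matching in `x`
  whose matched left vertices are among the processed roots, all of them if `x` has a perfect
  matching; `PhaseInv.succ`, `phaseInv_phasesSt`, whence `pmFn_eq_true_iff`.

## References

* [KorteVygen2018] B. Korte, J. Vygen, *Combinatorial Optimization* (2018), §10.1, Thm. 10.3
  (Hall), Thm. 10.5 (Kuhn's augmenting-path algorithm), Thm. 10.7 (Berge), PDF pp. 238–240.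
* [HopcroftKarp1973] J. E. Hopcroft, R. M. Karp, SIAM J. Comput. 2 (1973) 225–231.
* [Jukna2012] S. Jukna, *Boolean Function Complexity* (2012), §9.11 (PDF p. 291).
-/

namespace Literature.Computability.Complexity

namespace BipMatch

variable {m : ℕ}

/-- The bipartite graph `x ⊆ K_{m,m}` (rows = left vertices, columns = right vertices) has a
perfect matching: some permutation `σ` has all edges `(i, σ i)` present. This is literally the
predicate decided by the logical permanent `Literature.Barriers.PneNP.perfectMatchingFn m x`
(`perfectMatchingFn_eq_true_iff`; the barrier catalogue imports this directory, not conversely,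
whence the Prop is spelled out here rather than imported). [cite: Jukna2012, §9.11 (PDF p. 291)] -/
def HasPM (x : Fin m × Fin m → Bool) : Prop := ∃ σ : Equiv.Perm (Fin m), ∀ i, x (i, σ i) = true

/-! ### The invariant of the alternating breadth-first search -/

/-- Invariant of the alternating BFS from the root `u` after `n` rounds: the root is reached;
every other reached left vertex is matched and its mate is reached; mates of reached right
vertices are reached; parent edges are edges from reached to reached vertices; every reached
right vertex has exactly one parent; and there is a rank function on right vertices, bounded by
`n` on reached ones, that strictly decreases from a right vertex to the mate of its parent.
[folklore] -/
structure BfsInv (u : Fin m) (n : ℕ) (y : St m → Bool) : Prop where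
  /-- the root is reached -/
  root : y (.s u) = true
  /-- non-root reached left vertices are matched into `T` -/
  s_matched : ∀ v, y (.s v) = true → v ≠ u → ∃ w, y (.mt v w) = true ∧ y (.t w) = true
  /-- mates of reached right vertices are reached -/
  t_mate : ∀ v w, y (.t w) = true → y (.mt v w) = true → y (.s v) = true
  /-- parent edges are edges between reached vertices -/
  p_edge : ∀ v w, y (.p v w) = true → y (.x v w) = true ∧ y (.s v) = true ∧ y (.t w) = true
  /-- reached right vertices have a parent -/
  p_exists : ∀ w, y (.t w) = true → ∃ v, y (.p v w) = true
  /-- parents are unique -/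
  p_unique : ∀ v v' w, y (.p v w) = true → y (.p v' w) = true → v = v'
  /-- a rank decreasing along parent-then-mate steps -/
  rank : ∃ ρ : Fin m → ℕ, (∀ w, y (.t w) = true → ρ w ≤ n) ∧
    ∀ v w w', y (.p v w) = true → v ≠ u → y (.mt v w') = true → ρ w' < ρ w

/-- The invariant holds at the start of a phase (`S = {u}`, `T = P = ∅`). [folklore] -/
theorem bfsInv_resetSt (u : Fin m) (y : St m → Bool) : BfsInv u 0 (resetSt u y) where
  root := by simp
  s_matched v hv hvu := by simp at hv; exact absurd hv hvu
  t_mate v w ht _ := by simp at ht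
  p_edge v w hp := by simp at hp
  p_exists w ht := by simp at ht
  p_unique v v' w hp _ := by simp at hp
  rank := ⟨fun _ => 0, fun w ht => by simp at ht, fun v w w' hp => by simp at hp⟩

/-- One BFS round preserves the invariant (the matching must be row-unique). [folklore] -/
theorem BfsInv.step {u : Fin m} {n : ℕ} {y : St m → Bool} (h : BfsInv u n y)
    (hrow : ∀ v w w', y (.mt v w) = true → y (.mt v w') = true → w = w') :
    BfsInv u (n + 1) (bfsSt y) := by
  obtain ⟨ρ, hρT, hρ⟩ := h.rank
  refine ⟨?_, ?_, ?_, ?_, ?_, ?_, ?_⟩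
  · exact (bfsSt_s y u).2 (Or.inl h.root)
  · intro v hv hvu
    rcases (bfsSt_s y v).1 hv with hv' | ⟨w, hw, hmw⟩
    · obtain ⟨w, hmw, htw⟩ := h.s_matched v hv' hvu
      exact ⟨w, by simpa using hmw, (bfsSt_t y w).2 (Or.inl htw)⟩
    · exact ⟨w, by simpa using hmw, hw⟩
  · intro v w htw hmw
    rw [bfsSt_mt] at hmw
    exact (bfsSt_s y v).2 (Or.inr ⟨w, htw, hmw⟩)
  · intro v w hp
    rcases (bfsSt_p y v w).1 hp with hp' | ⟨-, hsv, hxvw, -⟩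
    · obtain ⟨hx, hs, ht⟩ := h.p_edge v w hp'
      exact ⟨by simpa using hx, (bfsSt_s y v).2 (Or.inl hs), (bfsSt_t y w).2 (Or.inl ht)⟩
    · exact ⟨by simpa using hxvw, (bfsSt_s y v).2 (Or.inl hsv),
        (bfsSt_t y w).2 (Or.inr ⟨v, hsv, hxvw⟩)⟩
  · intro w htw
    by_cases ht : y (.t w) = true
    · obtain ⟨v, hv⟩ := h.p_exists w ht
      exact ⟨v, (bfsSt_p y v w).2 (Or.inl hv)⟩
    · rcases (bfsSt_t y w).1 htw with ht' | hex
      · exact absurd ht' ht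
      · refine ⟨Fin.find _ hex, (bfsSt_p y _ w).2 (Or.inr ⟨by simpa using ht,
          (Fin.find_spec hex).1, (Fin.find_spec hex).2, fun v' hv' => ?_⟩)⟩
        have hmin : ¬ (y (.s v') = true ∧ y (.x v' w) = true) := Fin.find_min hex hv'
        by_cases hs' : y (.s v') = true
        · right; simpa using fun hx' => hmin ⟨hs', hx'⟩
        · left; simpa using hs'
  · intro v v' w hp hp'
    rcases (bfsSt_p y v w).1 hp with hp₁ | ⟨ht₁, hs₁, hx₁, hmin₁⟩ <;>
      rcases (bfsSt_p y v' w).1 hp' with hp₂ | ⟨ht₂, hs₂, hx₂, hmin₂⟩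
    · exact h.p_unique v v' w hp₁ hp₂
    · have := (h.p_edge v w hp₁).2.2; simp [this] at ht₂
    · have := (h.p_edge v' w hp₂).2.2; simp [this] at ht₁
    · rcases lt_trichotomy v v' with hlt | heq | hgt
      · rcases hmin₂ v hlt with hs | hx
        · simp [hs] at hs₁
        · simp [hx] at hx₁
      · exact heq
      · rcases hmin₁ v' hgt with hs | hx
        · simp [hs] at hs₂
        · simp [hx] at hx₂
  · refine ⟨fun w => if y (.t w) = true then ρ w else n + 1, ?_, ?_⟩
    · intro w _
      dsimp only
      split_ifs with ht
      · exact (hρT w ht).trans (Nat.le_succ n)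
      · exact le_rfl
    · intro v w w' hp hvu hmw
      rw [bfsSt_mt] at hmw
      have hsv : y (.s v) = true := by
        rcases (bfsSt_p y v w).1 hp with hp' | ⟨-, hs, -⟩
        · exact (h.p_edge v w hp').2.1
        · exact hs
      obtain ⟨w'', hmw'', htw''⟩ := h.s_matched v hsv hvu
      obtain rfl : w' = w'' := hrow v w' w'' hmw hmw''
      simp only [htw'', if_true]
      rcases (bfsSt_p y v w).1 hp with hp' | ⟨htw, -, -, -⟩
      · rw [if_pos (h.p_edge v w hp').2.2]
        exact hρ v w w' hp' hvu hmw
      · rw [if_neg (by simp [htw])]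
        exact Nat.lt_succ_of_le (hρT w' htw'')

/-- The invariant after `n` rounds from the initial state of phase `u`. [folklore] -/
theorem bfsInv_iterate (u : Fin m) (y : St m → Bool)
    (hrow : ∀ v w w', y (.mt v w) = true → y (.mt v w') = true → w = w') (n : ℕ) :
    BfsInv u n (bfsSt^[n] (resetSt u y)) := by
  induction n with
  | zero => exact bfsInv_resetSt u y
  | succ n ih =>
    rw [Function.iterate_succ_apply']
    refine ih.step ?_
    intro v w w'
    rw [bfsSt_iterate_mt, bfsSt_iterate_mt, resetSt_mt, resetSt_mt]
    exact hrow v w w'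

/-- The invariant only speaks about coordinates that the selection layer passes through.
[folklore] -/
theorem BfsInv.chooseSt {u : Fin m} {n : ℕ} {y : St m → Bool} (h : BfsInv u n y) :
    BfsInv u n (chooseSt y) :=
  ⟨h.root, h.s_matched, h.t_mate, h.p_edge, h.p_exists, h.p_unique, h.rank⟩

/-- … and through the path layer. [folklore] -/
theorem BfsInv.pathSt {u : Fin m} {n : ℕ} {y : St m → Bool} (h : BfsInv u n y) :
    BfsInv u n (pathSt y) :=
  ⟨h.root, h.s_matched, h.t_mate, h.p_edge, h.p_exists, h.p_unique, h.rank⟩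

/-- … and through iterated path layers. [folklore] -/
theorem BfsInv.pathSt_iterate {u : Fin m} {n : ℕ} {y : St m → Bool} (h : BfsInv u n y) (k : ℕ) :
    BfsInv u n (BipMatch.pathSt^[k] y) := by
  induction k with
  | zero => exact h
  | succ k ih => rw [Function.iterate_succ_apply']; exact ih.pathSt

/-! ### The search stabilises within `2m` rounds -/

/-- Potential of the BFS: number of reached vertices. [folklore] -/
def bfsPot (y : St m → Bool) : ℕ :=
  (Finset.univ.filter fun v => y (.s v) = true).card +
    (Finset.univ.filter fun w => y (.t w) = true).card

/-- The BFS potential is at most `2m`. [folklore] -/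
theorem bfsPot_le (y : St m → Bool) : bfsPot y ≤ 2 * m := by
  have h1 := Finset.card_filter_le (Finset.univ : Finset (Fin m)) fun v => y (.s v) = true
  have h2 := Finset.card_filter_le (Finset.univ : Finset (Fin m)) fun w => y (.t w) = true
  simp only [Finset.card_univ, Fintype.card_fin] at h1 h2
  unfold bfsPot; omega

/-- A BFS round only adds reached left vertices. [folklore] -/
theorem filter_s_subset (y : St m → Bool) :
    (Finset.univ.filter fun v => y (.s v) = true) ⊆
      Finset.univ.filter fun v => bfsSt y (.s v) = true := by
  intro v hv
  simp only [Finset.mem_filter, Finset.mem_univ, true_and] at hv ⊢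
  exact (bfsSt_s y v).2 (Or.inl hv)

/-- A BFS round only adds reached right vertices. [folklore] -/
theorem filter_t_subset (y : St m → Bool) :
    (Finset.univ.filter fun w => y (.t w) = true) ⊆
      Finset.univ.filter fun w => bfsSt y (.t w) = true := by
  intro w hw
  simp only [Finset.mem_filter, Finset.mem_univ, true_and] at hw ⊢
  exact (bfsSt_t y w).2 (Or.inl hw)

/-- A BFS round does not decrease the potential. [folklore] -/
theorem bfsPot_mono (y : St m → Bool) : bfsPot y ≤ bfsPot (bfsSt y) :=
  Nat.add_le_add (Finset.card_le_card (filter_s_subset y)) (Finset.card_le_card (filter_t_subset y))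

/-- A BFS round that does not raise the potential changes nothing. [folklore] -/
theorem bfsSt_fixed_of_pot (y : St m → Bool) (h : bfsPot (bfsSt y) = bfsPot y) : bfsSt y = y := by
  have hcA := Finset.card_le_card (filter_s_subset y)
  have hcB := Finset.card_le_card (filter_t_subset y)
  unfold bfsPot at h
  have hA := Finset.eq_of_subset_of_card_le (filter_s_subset y) (by omega)
  have hB := Finset.eq_of_subset_of_card_le (filter_t_subset y) (by omega)
  have hS : ∀ v, bfsSt y (.s v) = y (.s v) := fun v => by
    have := congrArg (v ∈ ·) hA
    simp only [Finset.mem_filter, Finset.mem_univ, true_and, eq_iff_iff] at this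
    exact Bool.eq_iff_iff.2 this.symm
  have hT : ∀ w, bfsSt y (.t w) = y (.t w) := fun w => by
    have := congrArg (w ∈ ·) hB
    simp only [Finset.mem_filter, Finset.mem_univ, true_and, eq_iff_iff] at this
    exact Bool.eq_iff_iff.2 this.symm
  funext k
  cases k with
  | s v => exact hS v
  | t w => exact hT w
  | p v w =>
    apply Bool.eq_iff_iff.2
    rw [bfsSt_p]
    constructor
    · rintro (hp | ⟨htw, hsv, hxvw, -⟩)
      · exact hp
      · have h' : bfsSt y (.t w) = true := (bfsSt_t y w).2 (Or.inr ⟨v, hsv, hxvw⟩)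
        rw [hT w] at h'
        simp [h'] at htw
    · exact Or.inl
  | _ => rfl

/-- After `2m` rounds the search is complete (a fixed point of the round map). [folklore] -/
theorem bfsSt_run_fixed (z : St m → Bool) : bfsSt (bfsSt^[2 * m] z) = bfsSt^[2 * m] z :=
  iterate_fixed_of_potential bfsSt bfsPot (2 * m) bfsPot_mono bfsSt_fixed_of_pot bfsPot_le z

/-! ### Failure: a Hall violator -/

/-- If the completed search from the unmatched root `u` reaches only matched right vertices,
then the reached sets `S ⊇ {u} ∪ mates(T)`, `T ⊇ N(S)` violate Hall's condition
(`|T| = |S| - 1`), so the graph has no perfect matching (the easy direction of Hall's theorem).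
[cite: KorteVygen2018, Thm. 10.3 (Hall), PDF p. 238] -/
theorem not_hasPM_of_stuck {u : Fin m} {n : ℕ} {y : St m → Bool} {x : Fin m × Fin m → Bool}
    (hx : ∀ v w, y (.x v w) = x (v, w)) (hinv : BfsInv u n y) (hfix : bfsSt y = y)
    (hrow : ∀ v w w', y (.mt v w) = true → y (.mt v w') = true → w = w')
    (hfree : ∀ w, y (.mt u w) = false)
    (hstuck : ∀ w, y (.t w) = true → ∃ v, y (.mt v w) = true) : ¬ HasPM x := by
  classical
  rintro ⟨σ, hσ⟩
  set S := Finset.univ.filter fun v => y (.s v) = true with hS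
  set T := Finset.univ.filter fun w => y (.t w) = true with hT
  have hclos : ∀ v w, y (.s v) = true → y (.x v w) = true → y (.t w) = true := by
    intro v w hs hxe
    have := (bfsSt_t y w).2 (Or.inr ⟨v, hs, hxe⟩)
    rwa [hfix] at this
  have h1 : S.card ≤ T.card := by
    refine Finset.card_le_card_of_injOn (fun v => σ v) ?_ ?_
    · intro v hv
      simp only [hS, hT, Finset.coe_filter, Finset.mem_univ, true_and, Set.mem_setOf_eq] at hv ⊢
      exact hclos v (σ v) hv (by rw [hx]; exact hσ v)
    · intro v _ v' _ h
      exact σ.injective h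
  have h2 : T.card ≤ (S.erase u).card := by
    refine Finset.card_le_card_of_injOn
      (fun w => if h : ∃ v, y (.mt v w) = true then h.choose else u) ?_ ?_
    · intro w hw
      simp only [hT, Finset.coe_filter, Finset.mem_univ, true_and, Set.mem_setOf_eq] at hw
      have h := hstuck w hw
      dsimp only
      rw [dif_pos h]
      have hm := h.choose_spec
      simp only [hS, Finset.mem_coe, Finset.mem_erase, Finset.mem_filter, Finset.mem_univ,
        true_and]
      refine ⟨fun heq => ?_, hinv.t_mate _ w hw hm⟩
      rw [heq] at hm
      simp [hfree w] at hm
    · intro w hw w' hw' heq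
      simp only [hT, Finset.coe_filter, Finset.mem_univ, true_and, Set.mem_setOf_eq] at hw hw'
      have h := hstuck w hw
      have h' := hstuck w' hw'
      simp only [dif_pos h, dif_pos h'] at heq
      have hm := h.choose_spec
      have hm' := h'.choose_spec
      rw [heq] at hm
      exact hrow _ w w' hm hm'
  have h3 : (S.erase u).card + 1 = S.card :=
    Finset.card_erase_add_one (by simp [hS, hinv.root])
  omega


/-! ### Selection of the free vertex -/

/-- If the selection succeeds, the `wsel` coordinates single out one reached unmatched right vertex `w₀`. [folklore] -/
theorem chooseSt_spec (y : St m → Bool) (hok : chooseSt y .ok = true) :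
    ∃ w₀, y (.t w₀) = true ∧ (∀ v, y (.mt v w₀) = false) ∧
      ∀ w, chooseSt y (.wsel w) = decide (w = w₀) := by
  rw [chooseSt_ok] at hok
  refine ⟨Fin.find _ hok, (Fin.find_spec hok).1, (Fin.find_spec hok).2, fun w => ?_⟩
  apply Bool.eq_iff_iff.2
  rw [decide_eq_true_iff, chooseSt_wsel, show (w = Fin.find _ hok ↔ Fin.find _ hok = w) from eq_comm,
    Fin.find_eq_iff, and_assoc]
  refine and_congr_right fun _ => and_congr_right fun _ => forall₂_congr fun w' _ => ?_
  constructor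
  · rintro (h | ⟨v, hv⟩) ⟨ht, hf⟩
    · simp [h] at ht
    · simp [hf v] at hv
  · intro h
    by_cases ht : y (.t w') = true
    · right
      by_contra hne
      exact h ⟨ht, fun v => by simpa using (not_exists.1 hne) v⟩
    · left; simpa using ht

/-- If the selection fails, every reached right vertex is matched. [folklore] -/
theorem stuck_of_not_ok (y : St m → Bool) (hok : chooseSt y .ok = false) (w : Fin m)
    (ht : y (.t w) = true) : ∃ v, y (.mt v w) = true := by
  by_contra hne
  have : chooseSt y .ok = true :=
    (chooseSt_ok y).2 ⟨w, ht, fun v => by simpa using (not_exists.1 hne) v⟩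
  simp [hok] at this

/-! ### The augmenting path as a chain of right vertices -/

/-- The successor of a right vertex `w` along the alternating tree, read backwards: the mate of
the parent of `w` (none if the parent is the root `u` or is unmatched). [folklore] -/
noncomputable def nextR (u : Fin m) (z : St m → Bool) (w : Fin m) : Option (Fin m) :=
  if h : ∃ w' v, z (.p v w) = true ∧ v ≠ u ∧ z (.mt v w') = true then some h.choose else none

/-- The chain `w₀, next w₀, next (next w₀), …` of right vertices of the augmenting path, from
the selected free vertex back towards the root. [folklore] -/
noncomputable def chain (u : Fin m) (z : St m → Bool) (w₀ : Fin m) : ℕ → Option (Fin m)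
  | 0 => some w₀
  | n + 1 => (chain u z w₀ n).bind (nextR u z)

/-- Right vertices on the augmenting path. [folklore] -/
def OnR (u : Fin m) (z : St m → Bool) (w₀ w : Fin m) : Prop := ∃ k, chain u z w₀ k = some w

/-- Left vertices on the augmenting path: the parents of its right vertices. [folklore] -/
def OnL (u : Fin m) (z : St m → Bool) (w₀ v : Fin m) : Prop :=
  ∃ w, OnR u z w₀ w ∧ z (.p v w) = true

/-- The augmented matching `M △ E(P)` along the augmenting path `P`: parent edges into right
path vertices, and the old matching edges off the path.
[cite: KorteVygen2018, Def. 10.6 and Thm. 10.7 (Berge), PDF p. 240] -/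
def NewM (u : Fin m) (z : St m → Bool) (w₀ v w : Fin m) : Prop :=
  (OnR u z w₀ w ∧ z (.p v w) = true) ∨ (z (.mt v w) = true ∧ ¬ OnL u z w₀ v ∧ ¬ OnR u z w₀ w)

/-- The hypotheses of the path analysis: a completed search from the unmatched root `u` of a
matching, and a reached free right vertex `w₀` that is the selected one. [folklore] -/
structure PathCtx (u : Fin m) (n : ℕ) (z : St m → Bool) (w₀ : Fin m) : Prop where
  /-- the search invariant -/
  inv : BfsInv u n z
  /-- the matching is row-unique -/
  row : ∀ v w w', z (.mt v w) = true → z (.mt v w') = true → w = w'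
  /-- the matching is column-unique -/
  col : ∀ v v' w, z (.mt v w) = true → z (.mt v' w) = true → v = v'
  /-- the root is unmatched -/
  free_root : ∀ w, z (.mt u w) = false
  /-- the selected vertex is reached -/
  t₀ : z (.t w₀) = true
  /-- the selected vertex is unmatched -/
  free₀ : ∀ v, z (.mt v w₀) = false
  /-- the selection coordinates single out `w₀` -/
  wsel : ∀ w, z (.wsel w) = decide (w = w₀)

section path

variable {u : Fin m} {n : ℕ} {z : St m → Bool} {w₀ : Fin m}

/-- Characterisation of the successor (parents and mates being unique). [folklore] -/
theorem nextR_eq_some (hinv : BfsInv u n z)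
    (hrow : ∀ v w w', z (.mt v w) = true → z (.mt v w') = true → w = w') {w w' : Fin m} :
    nextR u z w = some w' ↔ ∃ v, z (.p v w) = true ∧ v ≠ u ∧ z (.mt v w') = true := by
  unfold nextR
  constructor
  · intro h
    by_cases hex : ∃ w' v, z (.p v w) = true ∧ v ≠ u ∧ z (.mt v w') = true
    · rw [dif_pos hex, Option.some.injEq] at h
      obtain ⟨v, hv⟩ := hex.choose_spec
      rw [h] at hv
      exact ⟨v, hv⟩
    · rw [dif_neg hex] at h
      exact absurd h (by simp)
  · rintro ⟨v, hp, hvu, hm⟩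
    have hex : ∃ w' v, z (.p v w) = true ∧ v ≠ u ∧ z (.mt v w') = true := ⟨w', v, hp, hvu, hm⟩
    rw [dif_pos hex]
    obtain ⟨v', hp', -, hm'⟩ := hex.choose_spec
    obtain rfl : v = v' := hinv.p_unique v v' w hp hp'
    rw [hrow v _ _ hm' hm]

/-- The chain starts at `w₀`. [folklore] -/
theorem chain_zero : chain u z w₀ 0 = some w₀ := rfl

/-- The chain proceeds by `nextR`. [folklore] -/
theorem chain_succ (k : ℕ) : chain u z w₀ (k + 1) = (chain u z w₀ k).bind (nextR u z) := rfl

/-- Once the chain has ended it stays ended. [folklore] -/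
theorem chain_none_mono {i j : ℕ} (h : chain u z w₀ i = none) (hij : i ≤ j) :
    chain u z w₀ j = none := by
  obtain ⟨d, rfl⟩ := Nat.exists_eq_add_of_le hij
  clear hij
  induction d with
  | zero => simpa using h
  | succ d ih => rw [← add_assoc, chain_succ, ih]; rfl

/-- Chain vertices are reached. [folklore] -/
theorem PathCtx.chain_t (c : PathCtx u n z w₀) :
    ∀ {k : ℕ} {w : Fin m}, chain u z w₀ k = some w → z (.t w) = true
  | 0, w, h => by rw [chain_zero, Option.some.injEq] at h; subst h; exact c.t₀
  | k + 1, w, h => by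
    rw [chain_succ] at h
    cases hk : chain u z w₀ k with
    | none => rw [hk] at h; simp at h
    | some w₁ =>
      rw [hk, Option.bind_some] at h
      obtain ⟨v, hp, hvu, hm⟩ := (nextR_eq_some c.inv c.row).1 h
      obtain ⟨w', hm', ht'⟩ := c.inv.s_matched v (c.inv.p_edge v w₁ hp).2.1 hvu
      obtain rfl := c.row v w w' hm hm'
      exact ht'

/-- The rank strictly decreases along the chain. [folklore] -/
theorem PathCtx.chain_rank (c : PathCtx u n z w₀) {ρ : Fin m → ℕ}
    (hρ : ∀ v w w', z (.p v w) = true → v ≠ u → z (.mt v w') = true → ρ w' < ρ w) :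
    ∀ (d k : ℕ) {a b : Fin m}, chain u z w₀ k = some a → chain u z w₀ (k + d) = some b →
      ρ b + d ≤ ρ a
  | 0, k, a, b, ha, hb => by
    rw [add_zero, ha, Option.some.injEq] at hb
    subst hb; simp
  | d + 1, k, a, b, ha, hb => by
    rw [← add_assoc, chain_succ] at hb
    cases hk : chain u z w₀ (k + d) with
    | none => rw [hk] at hb; simp at hb
    | some b' =>
      rw [hk, Option.bind_some] at hb
      have h1 := PathCtx.chain_rank c hρ d k ha hk
      obtain ⟨v, hp, hvu, hm⟩ := (nextR_eq_some c.inv c.row).1 hb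
      have h2 := hρ v b' b hp hvu hm
      omega

/-- The chain ends within `n + 1` steps. [folklore] -/
theorem PathCtx.chain_none (c : PathCtx u n z w₀) : chain u z w₀ (n + 1) = none := by
  obtain ⟨ρ, hρT, hρ⟩ := c.inv.rank
  cases h : chain u z w₀ (n + 1) with
  | none => rfl
  | some b =>
    have h1 := c.chain_rank hρ (n + 1) 0 chain_zero (by rwa [zero_add])
    have h2 := hρT w₀ c.t₀
    omega

/-- The chain does not repeat a vertex. [folklore] -/
theorem PathCtx.chain_inj (c : PathCtx u n z w₀) {i j : ℕ} {a : Fin m}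
    (hi : chain u z w₀ i = some a) (hj : chain u z w₀ j = some a) : i = j := by
  obtain ⟨ρ, -, hρ⟩ := c.inv.rank
  rcases le_total i j with h | h
  · obtain ⟨d, rfl⟩ := Nat.exists_eq_add_of_le h
    have := c.chain_rank hρ d i hi hj
    omega
  · obtain ⟨d, rfl⟩ := Nat.exists_eq_add_of_le h
    have := c.chain_rank hρ d j hj hi
    omega

/-- The chain ends at a right vertex whose parent is the root. [folklore] -/
theorem PathCtx.exists_root_parent (c : PathCtx u n z w₀) :
    ∃ k w, chain u z w₀ k = some w ∧ z (.p u w) = true := by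
  classical
  have hex : ∃ k, chain u z w₀ (k + 1) = none := ⟨n, c.chain_none⟩
  obtain ⟨k, hk, hmin⟩ : ∃ k, chain u z w₀ (k + 1) = none ∧ ∀ j, j < k → chain u z w₀ (j + 1) ≠ none :=
    ⟨Nat.find hex, Nat.find_spec hex, fun j hj => Nat.find_min hex hj⟩
  have hne : chain u z w₀ k ≠ none := by
    cases k with
    | zero => simp [chain_zero]
    | succ k => exact hmin k (Nat.lt_succ_self k)
  obtain ⟨w, hw⟩ := Option.ne_none_iff_exists'.1 hne
  obtain ⟨v, hp⟩ := c.inv.p_exists w (c.chain_t hw)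
  by_cases hvu : v = u
  · exact ⟨k, w, hw, hvu ▸ hp⟩
  · obtain ⟨w', hm', -⟩ := c.inv.s_matched v (c.inv.p_edge v w hp).2.1 hvu
    have h' : chain u z w₀ (k + 1) = some w' := by
      rw [chain_succ, hw, Option.bind_some]
      exact (nextR_eq_some c.inv c.row).2 ⟨v, hp, hvu, hm'⟩
    rw [hk] at h'
    exact absurd h' (by simp)

/-- Each left path vertex is the parent of exactly one right path vertex. [folklore] -/
theorem PathCtx.parent_inj (c : PathCtx u n z w₀) {v w₁ w₂ : Fin m} (h₁ : OnR u z w₀ w₁)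
    (h₂ : OnR u z w₀ w₂) (hp₁ : z (.p v w₁) = true) (hp₂ : z (.p v w₂) = true) : w₁ = w₂ := by
  obtain ⟨i, hi⟩ := h₁
  obtain ⟨j, hj⟩ := h₂
  by_cases hvu : v = u
  · have hn : ∀ {w}, z (.p v w) = true → nextR u z w = none := by
      intro w hp
      cases h : nextR u z w with
      | none => rfl
      | some w' =>
        obtain ⟨v', hp', hvu', -⟩ := (nextR_eq_some c.inv c.row).1 h
        exact absurd (hvu ▸ c.inv.p_unique v' v w hp' hp) hvu'
    have hi1 : chain u z w₀ (i + 1) = none := by rw [chain_succ, hi, Option.bind_some, hn hp₁]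
    have hj1 : chain u z w₀ (j + 1) = none := by rw [chain_succ, hj, Option.bind_some, hn hp₂]
    rcases lt_trichotomy i j with h | rfl | h
    · have := chain_none_mono hi1 (Nat.succ_le_of_lt h); rw [hj] at this; exact absurd this (by simp)
    · rw [hi, Option.some.injEq] at hj; exact hj
    · have := chain_none_mono hj1 (Nat.succ_le_of_lt h); rw [hi] at this; exact absurd this (by simp)
  · obtain ⟨w', hm', -⟩ := c.inv.s_matched v (c.inv.p_edge v w₁ hp₁).2.1 hvu
    have hi1 : chain u z w₀ (i + 1) = some w' := by
      rw [chain_succ, hi, Option.bind_some]; exact (nextR_eq_some c.inv c.row).2 ⟨v, hp₁, hvu, hm'⟩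
    have hj1 : chain u z w₀ (j + 1) = some w' := by
      rw [chain_succ, hj, Option.bind_some]; exact (nextR_eq_some c.inv c.row).2 ⟨v, hp₂, hvu, hm'⟩
    have hij : i = j := by have := c.chain_inj hi1 hj1; omega
    subst hij
    rw [hi, Option.some.injEq] at hj
    exact hj

/-! ### The path layers compute exactly the path -/

/-- Potential of the path tracing: number of marked vertices. [folklore] -/
def pathPot (y : St m → Bool) : ℕ :=
  (Finset.univ.filter fun v => y (.pl v) = true).card +
    (Finset.univ.filter fun w => y (.pr w) = true).card

/-- The path potential is at most `2m`. [folklore] -/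
theorem pathPot_le (y : St m → Bool) : pathPot y ≤ 2 * m := by
  have h1 := Finset.card_filter_le (Finset.univ : Finset (Fin m)) fun v => y (.pl v) = true
  have h2 := Finset.card_filter_le (Finset.univ : Finset (Fin m)) fun w => y (.pr w) = true
  simp only [Finset.card_univ, Fintype.card_fin] at h1 h2
  unfold pathPot; omega

/-- A path round only adds left path vertices. [folklore] -/
theorem filter_pl_subset (y : St m → Bool) :
    (Finset.univ.filter fun v => y (.pl v) = true) ⊆
      Finset.univ.filter fun v => pathSt y (.pl v) = true := by
  intro v hv
  simp only [Finset.mem_filter, Finset.mem_univ, true_and] at hv ⊢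
  exact (pathSt_pl y v).2 (Or.inl hv)

/-- A path round only adds right path vertices. [folklore] -/
theorem filter_pr_subset (y : St m → Bool) :
    (Finset.univ.filter fun w => y (.pr w) = true) ⊆
      Finset.univ.filter fun w => pathSt y (.pr w) = true := by
  intro w hw
  simp only [Finset.mem_filter, Finset.mem_univ, true_and] at hw ⊢
  exact (pathSt_pr y w).2 (Or.inl hw)

/-- A path round does not decrease the potential. [folklore] -/
theorem pathPot_mono (y : St m → Bool) : pathPot y ≤ pathPot (pathSt y) :=
  Nat.add_le_add (Finset.card_le_card (filter_pl_subset y))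
    (Finset.card_le_card (filter_pr_subset y))

/-- A path round that does not raise the potential changes nothing. [folklore] -/
theorem pathSt_fixed_of_pot (y : St m → Bool) (h : pathPot (pathSt y) = pathPot y) :
    pathSt y = y := by
  have hcA := Finset.card_le_card (filter_pl_subset y)
  have hcB := Finset.card_le_card (filter_pr_subset y)
  unfold pathPot at h
  have hA := Finset.eq_of_subset_of_card_le (filter_pl_subset y) (by omega)
  have hB := Finset.eq_of_subset_of_card_le (filter_pr_subset y) (by omega)
  funext k
  cases k with
  | pl v =>
    have := congrArg (v ∈ ·) hA
    simp only [Finset.mem_filter, Finset.mem_univ, true_and, eq_iff_iff] at this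
    exact Bool.eq_iff_iff.2 this.symm
  | pr w =>
    have := congrArg (w ∈ ·) hB
    simp only [Finset.mem_filter, Finset.mem_univ, true_and, eq_iff_iff] at this
    exact Bool.eq_iff_iff.2 this.symm
  | _ => rfl

/-- After `2m` rounds the path tracing is complete. [folklore] -/
theorem pathSt_run_fixed (z : St m → Bool) : pathSt (pathSt^[2 * m] z) = pathSt^[2 * m] z :=
  iterate_fixed_of_potential pathSt pathPot (2 * m) pathPot_mono pathSt_fixed_of_pot pathPot_le z

/-- The marked vertices always lie on the path. [folklore] -/
theorem PathCtx.closure_sub (c : PathCtx u n z w₀) (hpl : ∀ v, z (.pl v) = false)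
    (hpr : ∀ w, z (.pr w) = false) :
    ∀ k, (∀ w, (pathSt^[k] z) (.pr w) = true → OnR u z w₀ w) ∧
      (∀ v, (pathSt^[k] z) (.pl v) = true → OnL u z w₀ v)
  | 0 => ⟨fun w h => by simp [hpr w] at h, fun v h => by simp [hpl v] at h⟩
  | k + 1 => by
    obtain ⟨ihr, ihl⟩ := PathCtx.closure_sub c hpl hpr k
    have hR : ∀ w, pathSt (pathSt^[k] z) (.pr w) = true → OnR u z w₀ w := by
      intro w h
      rcases (pathSt_pr _ w).1 h with h | h | ⟨v, hv, hm⟩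
      · exact ihr w h
      · rw [pathSt_iterate_wsel, c.wsel] at h
        simp only [decide_eq_true_eq] at h
        exact ⟨0, by rw [chain_zero, h]⟩
      · rw [pathSt_iterate_mt] at hm
        obtain ⟨w₁, ⟨i, hi⟩, hp⟩ := ihl v hv
        have hvu : v ≠ u := fun h => by rw [h, c.free_root w] at hm; exact Bool.false_ne_true hm
        have hnext : chain u z w₀ (i + 1) = some w := by
          rw [chain_succ, hi, Option.bind_some]
          exact (nextR_eq_some c.inv c.row).2 ⟨v, hp, hvu, hm⟩
        exact ⟨i + 1, hnext⟩
    refine ⟨fun w h => hR w (by rwa [Function.iterate_succ_apply'] at h), fun v h => ?_⟩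
    rw [Function.iterate_succ_apply'] at h
    rcases (pathSt_pl _ v).1 h with h | ⟨w, hw, hp⟩
    · exact ihl v h
    · rw [pathSt_iterate_p] at hp
      exact ⟨w, hR w hw, hp⟩

/-- A fixed point of the path layer marks the whole path. [folklore] -/
theorem PathCtx.closure_sup (c : PathCtx u n z w₀) {q : St m → Bool} (k : ℕ)
    (hq : q = pathSt^[k] z) (hfix : pathSt q = q) :
    (∀ w, OnR u z w₀ w → q (.pr w) = true) ∧ (∀ v, OnL u z w₀ v → q (.pl v) = true) := by
  have h0 : q (.pr w₀) = true := by
    rw [← hfix]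
    refine (pathSt_pr q w₀).2 (Or.inr (Or.inl ?_))
    rw [hq, pathSt_iterate_wsel, c.wsel]
    simp
  have h1 : ∀ v w, q (.pl v) = true → z (.mt v w) = true → q (.pr w) = true := by
    intro v w hv hm
    rw [← hfix]
    exact (pathSt_pr q w).2 (Or.inr (Or.inr ⟨v, hv, by rw [hq, pathSt_iterate_mt]; exact hm⟩))
  have h2 : ∀ v w, q (.pr w) = true → z (.p v w) = true → q (.pl v) = true := by
    intro v w hw hp
    rw [← hfix]
    exact (pathSt_pl q v).2 (Or.inr ⟨w, by rw [hfix]; exact hw, by rw [hq, pathSt_iterate_p]; exact hp⟩)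
  have hR : ∀ i w, chain u z w₀ i = some w → q (.pr w) = true := by
    intro i
    induction i with
    | zero => intro w h; rw [chain_zero, Option.some.injEq] at h; subst h; exact h0
    | succ i ih =>
      intro w h
      rw [chain_succ] at h
      cases hi : chain u z w₀ i with
      | none => rw [hi] at h; simp at h
      | some w₁ =>
        rw [hi, Option.bind_some] at h
        obtain ⟨v, hp, -, hm⟩ := (nextR_eq_some c.inv c.row).1 h
        exact h1 v w (h2 v w₁ (ih w₁ hi) hp) hm
  exact ⟨fun w ⟨i, hi⟩ => hR i w hi, fun v ⟨w, ⟨i, hi⟩, hp⟩ => h2 v w (hR i w hi) hp⟩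

/-! ### The augmented matching -/

/-- Every edge of the augmented matching is a parent edge or an old matching edge. [folklore] -/
theorem PathCtx.newM_cases (_c : PathCtx u n z w₀) {v w : Fin m} (h : NewM u z w₀ v w) :
    z (.p v w) = true ∨ z (.mt v w) = true := by
  rcases h with ⟨-, hp⟩ | ⟨hm, -, -⟩
  · exact Or.inl hp
  · exact Or.inr hm

/-- The augmented matching is row-unique. [folklore] -/
theorem PathCtx.newM_row (c : PathCtx u n z w₀) {v w₁ w₂ : Fin m} (h₁ : NewM u z w₀ v w₁)
    (h₂ : NewM u z w₀ v w₂) : w₁ = w₂ := by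
  rcases h₁ with ⟨ho₁, hp₁⟩ | ⟨hm₁, hl₁, -⟩ <;> rcases h₂ with ⟨ho₂, hp₂⟩ | ⟨hm₂, hl₂, -⟩
  · exact c.parent_inj ho₁ ho₂ hp₁ hp₂
  · exact absurd (⟨w₁, ho₁, hp₁⟩ : OnL u z w₀ v) hl₂
  · exact absurd (⟨w₂, ho₂, hp₂⟩ : OnL u z w₀ v) hl₁
  · exact c.row v w₁ w₂ hm₁ hm₂

/-- The augmented matching is column-unique. [folklore] -/
theorem PathCtx.newM_col (c : PathCtx u n z w₀) {v₁ v₂ w : Fin m} (h₁ : NewM u z w₀ v₁ w)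
    (h₂ : NewM u z w₀ v₂ w) : v₁ = v₂ := by
  rcases h₁ with ⟨ho₁, hp₁⟩ | ⟨hm₁, -, hr₁⟩ <;> rcases h₂ with ⟨ho₂, hp₂⟩ | ⟨hm₂, -, hr₂⟩
  · exact c.inv.p_unique v₁ v₂ w hp₁ hp₂
  · exact absurd ho₁ hr₂
  · exact absurd ho₂ hr₁
  · exact c.col v₁ v₂ w hm₁ hm₂

/-- The augmented matching covers the root. [folklore] -/
theorem PathCtx.newM_root (c : PathCtx u n z w₀) : ∃ w, NewM u z w₀ u w := by
  obtain ⟨k, w, hk, hp⟩ := c.exists_root_parent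
  exact ⟨w, Or.inl ⟨⟨k, hk⟩, hp⟩⟩

/-- The augmented matching covers every previously matched left vertex. [folklore] -/
theorem PathCtx.newM_of_matched (c : PathCtx u n z w₀) {v w : Fin m} (hm : z (.mt v w) = true) :
    ∃ w', NewM u z w₀ v w' := by
  by_cases hl : OnL u z w₀ v
  · obtain ⟨w₁, ho, hp⟩ := hl
    exact ⟨w₁, Or.inl ⟨ho, hp⟩⟩
  · refine ⟨w, Or.inr ⟨hm, hl, fun ⟨i, hi⟩ => hl ?_⟩⟩
    cases i with
    | zero =>
      rw [chain_zero, Option.some.injEq] at hi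
      subst hi
      rw [c.free₀ v] at hm
      exact absurd hm Bool.false_ne_true
    | succ i =>
      rw [chain_succ] at hi
      cases h : chain u z w₀ i with
      | none => rw [h] at hi; simp at hi
      | some w₁ =>
        rw [h, Option.bind_some] at hi
        obtain ⟨v', hp, -, hm'⟩ := (nextR_eq_some c.inv c.row).1 hi
        obtain rfl := c.col v v' w hm hm'
        exact ⟨w₁, ⟨i, h⟩, hp⟩

/-- The augmented matching covers only the root and previously matched left vertices. [folklore] -/
theorem PathCtx.matched_of_newM (c : PathCtx u n z w₀) {v w : Fin m} (h : NewM u z w₀ v w) :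
    v = u ∨ ∃ w', z (.mt v w') = true := by
  rcases h with ⟨-, hp⟩ | ⟨hm, -, -⟩
  · by_cases hvu : v = u
    · exact Or.inl hvu
    · obtain ⟨w', hm', -⟩ := c.inv.s_matched v (c.inv.p_edge v w hp).2.1 hvu
      exact Or.inr ⟨w', hm'⟩
  · exact Or.inr ⟨w, hm⟩

end path

/-! ### The invariant of the phases -/

/-- Invariant after the phases of the roots `< u`: the state carries the input graph and a
matching in it whose matched left vertices are among the processed roots — all of them if the
graph has a perfect matching. [folklore] -/
structure PhaseInv (x : Fin m × Fin m → Bool) (u : ℕ) (y : St m → Bool) : Prop where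
  /-- the edge coordinates hold the input -/
  edges : ∀ v w, y (.x v w) = x (v, w)
  /-- the matching uses edges only -/
  sub : ∀ v w, y (.mt v w) = true → x (v, w) = true
  /-- row-uniqueness -/
  row : ∀ v w w', y (.mt v w) = true → y (.mt v w') = true → w = w'
  /-- column-uniqueness -/
  col : ∀ v v' w, y (.mt v w) = true → y (.mt v' w) = true → v = v'
  /-- only processed roots are matched -/
  dom : ∀ v w, y (.mt v w) = true → (v : ℕ) < u
  /-- if a perfect matching exists, every processed root is matched -/
  full : HasPM x → ∀ v : Fin m, (v : ℕ) < u → ∃ w, y (.mt v w) = true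

/-- The invariant holds initially (empty matching). [folklore] -/
theorem phaseInv_initSt (x : Fin m × Fin m → Bool) : PhaseInv x 0 (initSt x) where
  edges _ _ := rfl
  sub v w h := by simp at h
  row v w w' h := by simp at h
  col v v' w h := by simp at h
  dom v w h := by simp at h
  full _ _ hv := absurd hv (Nat.not_lt_zero _)

/-- **One phase preserves the invariant** (Kuhn's augmenting-path step: augment along the path
found by the alternating search — Berge — or certify by a Hall violator that no perfect matching
exists). [cite: KorteVygen2018, Thm. 10.5 and Thm. 10.7, PDF pp. 239–240] -/
theorem PhaseInv.succ {x : Fin m × Fin m → Bool} {u : ℕ} {y : St m → Bool} (h : PhaseInv x u y)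
    (hu : u < m) : PhaseInv x (u + 1) (phaseSt ⟨u, hu⟩ y) := by
  set root : Fin m := ⟨u, hu⟩ with hroot
  set yB := bfsSt^[2 * m] (resetSt root y) with hyB
  set z := chooseSt yB with hz
  set q := pathSt^[2 * m] z with hq
  have hr : phaseSt root y = augmentSt q := rfl
  have yBx : ∀ v w, yB (.x v w) = x (v, w) := fun v w => by
    rw [hyB, bfsSt_iterate_x, resetSt_x, h.edges]
  have yBmt : ∀ v w, yB (.mt v w) = y (.mt v w) := fun v w => by
    rw [hyB, bfsSt_iterate_mt, resetSt_mt]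
  have zx : ∀ v w, z (.x v w) = x (v, w) := fun v w => by rw [hz, chooseSt_x, yBx]
  have zmt : ∀ v w, z (.mt v w) = y (.mt v w) := fun v w => by rw [hz, chooseSt_mt, yBmt]
  have qmt : ∀ v w, q (.mt v w) = y (.mt v w) := fun v w => by rw [hq, pathSt_iterate_mt, zmt]
  have qp : ∀ v w, q (.p v w) = z (.p v w) := fun v w => by rw [hq, pathSt_iterate_p]
  have qok : q .ok = z .ok := by rw [hq, pathSt_iterate_ok]
  have hfree : ∀ w, y (.mt root w) = false := fun w => by
    by_contra hne
    have := h.dom root w (by simpa using hne)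
    simp [hroot] at this
  have hrowB : ∀ v w w', yB (.mt v w) = true → yB (.mt v w') = true → w = w' := by
    intro v w w'; rw [yBmt, yBmt]; exact h.row v w w'
  have hinvB : BfsInv root (2 * m) yB := bfsInv_iterate root y h.row (2 * m)
  have hfixB : bfsSt yB = yB := bfsSt_run_fixed _
  have hedges : ∀ v w, phaseSt root y (.x v w) = x (v, w) := fun v w => by rw [phaseSt_x, h.edges]
  have key : ∀ v w, phaseSt root y (.mt v w) = true ↔
      (z .ok = true ∧ ((q (.pr w) = true ∧ z (.p v w) = true) ∨
        (y (.mt v w) = true ∧ q (.pl v) = false ∧ q (.pr w) = false))) ∨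
      (z .ok = false ∧ y (.mt v w) = true) := by
    intro v w; rw [hr, augmentSt_mt, qok, qp, qmt]
  by_cases hok : z .ok = true
  · obtain ⟨w₀, ht₀, hfree₀, hwsel⟩ := chooseSt_spec yB (by rw [← hz]; exact hok)
    have c : PathCtx root (2 * m) z w₀ :=
      { inv := hinvB.chooseSt
        row := by intro v w w'; rw [zmt, zmt]; exact h.row v w w'
        col := by intro v v' w; rw [zmt, zmt]; exact h.col v v' w
        free_root := fun w => by rw [zmt]; exact hfree w
        t₀ := by rw [hz, chooseSt_t]; exact ht₀
        free₀ := fun v => by rw [hz, chooseSt_mt]; exact hfree₀ v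
        wsel := fun w => by rw [hz]; exact hwsel w }
    have hfixq : pathSt q = q := pathSt_run_fixed z
    obtain ⟨hsubR, hsubL⟩ := c.closure_sub (fun v => by rw [hz, chooseSt_pl])
      (fun w => by rw [hz, chooseSt_pr]) (2 * m)
    obtain ⟨hsupR, hsupL⟩ := c.closure_sup (2 * m) hq hfixq
    have key' : ∀ v w, phaseSt root y (.mt v w) = true ↔ NewM root z w₀ v w := by
      intro v w
      rw [key v w]
      simp only [hok, true_and, Bool.true_eq_false, false_and, or_false, NewM]
      have e1 : q (.pr w) = true ↔ OnR root z w₀ w := ⟨hsubR w, hsupR w⟩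
      have e1' : q (.pl v) = true ↔ OnL root z w₀ v := ⟨hsubL v, hsupL v⟩
      have e2 : q (.pl v) = false ↔ ¬ OnL root z w₀ v := by rw [← e1']; simp
      have e3 : q (.pr w) = false ↔ ¬ OnR root z w₀ w := by rw [← e1]; simp
      rw [e1, e2, e3, zmt]
    refine ⟨hedges, ?_, ?_, ?_, ?_, ?_⟩
    · intro v w hm
      rcases c.newM_cases ((key' v w).1 hm) with hp | hm'
      · rw [← zx]; exact (c.inv.p_edge v w hp).1
      · rw [zmt] at hm'; exact h.sub v w hm'
    · intro v w w' h₁ h₂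
      exact c.newM_row ((key' v w).1 h₁) ((key' v w').1 h₂)
    · intro v v' w h₁ h₂
      exact c.newM_col ((key' v w).1 h₁) ((key' v' w).1 h₂)
    · intro v w hm
      rcases c.matched_of_newM ((key' v w).1 hm) with hv | ⟨w', hw'⟩
      · rw [hv]; exact Nat.lt_succ_self u
      · rw [zmt] at hw'; exact Nat.lt_succ_of_lt (h.dom v w' hw')
    · intro hpm v hv
      rcases Nat.lt_succ_iff_lt_or_eq.1 hv with hlt | heq
      · obtain ⟨w, hw⟩ := h.full hpm v hlt
        obtain ⟨w', hw'⟩ := c.newM_of_matched (v := v) (w := w) (by rw [zmt]; exact hw)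
        exact ⟨w', (key' v w').2 hw'⟩
      · have hv' : v = root := Fin.ext heq
        subst hv'
        obtain ⟨w, hw⟩ := c.newM_root
        exact ⟨w, (key' _ w).2 hw⟩
  · have hok' : z .ok = false := by simpa using hok
    have key' : ∀ v w, phaseSt root y (.mt v w) = y (.mt v w) := by
      intro v w
      apply Bool.eq_iff_iff.2
      rw [key v w]
      simp [hok']
    have hstuck : ∀ w, yB (.t w) = true → ∃ v, yB (.mt v w) = true :=
      stuck_of_not_ok yB (by rw [← hz]; exact hok')
    have hnpm : ¬ HasPM x :=
      not_hasPM_of_stuck yBx hinvB hfixB hrowB (fun w => by rw [yBmt]; exact hfree w) hstuck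
    refine ⟨hedges, ?_, ?_, ?_, ?_, fun hpm => absurd hpm hnpm⟩
    · intro v w hm; rw [key'] at hm; exact h.sub v w hm
    · intro v w w' h₁ h₂; rw [key'] at h₁ h₂; exact h.row v w w' h₁ h₂
    · intro v v' w h₁ h₂; rw [key'] at h₁ h₂; exact h.col v v' w h₁ h₂
    · intro v w hm; rw [key'] at hm; exact Nat.lt_succ_of_lt (h.dom v w hm)

/-- The invariant after `k ≤ m` phases. [folklore] -/
theorem phaseInv_phasesSt (x : Fin m × Fin m → Bool) :
    ∀ k, k ≤ m → PhaseInv x k (phasesSt k (initSt x))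
  | 0, _ => phaseInv_initSt x
  | k + 1, hk => by
    have hk' : k < m := hk
    have ih := phaseInv_phasesSt x k hk'.le
    show PhaseInv x (k + 1) (if h : k < m then phaseSt ⟨k, h⟩ (phasesSt k (initSt x))
      else phasesSt k (initSt x))
    rw [dif_pos hk']
    exact ih.succ hk'

/-- **Correctness of the augmenting-path circuit**: `pmFn` accepts exactly the bipartite graphs
`x ⊆ K_{m,m}` with a perfect matching (after the `m` phases the matching covers every left vertex
iff a perfect matching exists). [cite: KorteVygen2018, Thm. 10.5, PDF p. 239] -/
theorem pmFn_eq_true_iff (x : Fin m × Fin m → Bool) : pmFn x () = true ↔ HasPM x := by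
  have h := phaseInv_phasesSt x m le_rfl
  rw [pmFn, outSt_eq, decide_eq_true_iff]
  constructor
  · intro hall
    choose σ hσ using hall
    have hinj : Function.Injective σ := fun v v' hvv' =>
      h.col v v' (σ v) (hσ v) (by rw [hvv']; exact hσ v')
    exact ⟨Equiv.ofBijective σ (Finite.injective_iff_bijective.1 hinj), fun i => h.sub i (σ i) (hσ i)⟩
  · intro hpm v
    exact h.full hpm v v.isLt

end BipMatch

end Literature.Computability.Complexity
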